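import Summits.AtomisticToContinuum.FouriersLaw.Theses.CoercivePulse
import Summits.AtomisticToContinuum.FouriersLaw.Theses.LatticeLandauDamping
import Summits.AtomisticToContinuum.FouriersLaw.Theorems.CoercivePulseLinearCeilingSpectralRepresentation
import Summits.AtomisticToContinuum.FouriersLaw.Theorems.CoercivePulseLinearCeilingHelfandMoment
import Summits.AtomisticToContinuum.FouriersLaw.Theorems.CoercivePulseLinearCeilingEnvelopeOfSpectralAbelBound
import Summits.AtomisticToContinuum.FouriersLaw.Theorems.EmbeddedDrudeMourreAbelOfSpectralDensity
import HarnessLib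

/-!
# `LatticeLandauDamping.WindowDecomposition ∧ NoDrudeWeight ⇒ CoercivePulse.LinearCeiling`

Line `SpikeLemma` of crux `CoercivePulse.LinearCeiling` (item stmt-AtomisticToContinuum-15383), lead c1, 2026-08-17:
a SECOND close-on-close supplier of the crux, over landed theorems only. Besides the route's own (R)
(`UniformAbelianRegularity`, stmt-13416; certificate `linearCeiling_of_uniformAbelianRegularity`), the pair of cruxes of
the sibling route `LatticeLandauDamping`

* `WindowDecomposition` (stmt-AtomisticToContinuum-14011): at every `T > 0` some shift-invariant DLR state `μ_T` with a
  `μ_T`-preserving dynamics has `C_T(t) = ∫cos(ωt)dσ` with `σ|(−δ,δ) = σ{0}·δ₀ + g·Lebesgue`, `g` continuous `≥ 0`;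
* `NoDrudeWeight` (stmt-AtomisticToContinuum-14012): every such spectral measure has no atom at `0`,

implies the infinite-volume Abel ceiling (AC) of `C_T` for EVERY guarded pair, hence `LinearCeiling`:

1. at bath constant `1` (the bath constant is inert for `U`, `V`, the DLR state and the dynamics) the window pair's
   spectral measure is `g·Lebesgue` near `0` (`σ{0} = 0`), so its Abel means CONVERGE (`π·g(0)`, the landed item
   `AbelOfSpectralDensity`, stmt-12598) and are bounded on some `(0, ν₀)`;
2. the window pair's `C_T` IS the `C_T` of every guarded pair `(μ, D)`: `μ = μ_T` by uniqueness of the shift-invariant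
   DLR state, and both dynamics coincide `μ`-a.e. with the canonical Buttà–Marchioro flow (canonical twins with the
   common carrier `bmGood`, uniqueness of good orbits);
3. (AC) ⇒ `LinearCeiling` by cosine Bochner + the Fejér/Abel kernel comparison + Helfand's identity (the landed stubs of
   the line).

[cite: BonettoLebowitzReyBellet2000, §7 eq. (37)] [cite: Helfand1960, §II]
-/

noncomputable section

namespace Summit.AtomisticToContinuum.FouriersLaw.Theorems.LinearCeiling.SpikeLemma

open MeasureTheory Filter Set
open scoped Topology BigOperators
open Literature.MathematicalPhysics.KineticTheory.HeatConduction
open Summit.AtomisticToContinuum.FouriersLaw.Theses.CoercivePulse (LinearCeiling)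
open Summit.AtomisticToContinuum.FouriersLaw.Theses.LatticeLandauDamping (WindowDecomposition NoDrudeWeight)

/-- **Window pair without Drude atom ⇒ the infinite-volume Abel ceiling (AC) for every guarded pair.**
`WindowDecomposition` (stmt-14011) and `NoDrudeWeight` (stmt-14012) of route `LatticeLandauDamping` imply: for every
guarded pair `(μ, D)` of the pinned anharmonic chain (any bath constant `γ`) the Abel means
`∫₀^∞ e^{−νt} C_T(t) dt` are bounded above on some `(0, ν₀)` — they even converge, to `π g(0)`
(`AbelOfSpectralDensity`), and the guarded pair's `C_T` is the window pair's (DLR uniqueness + canonical twins).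
[cite: BonettoLebowitzReyBellet2000, §7 eq. (37)] -/
theorem abelCeiling_of_windowDecomposition_of_noDrudeWeight (hW : WindowDecomposition) (hN : NoDrudeWeight) :
    ∀ ω₂ lam β γ : ℝ, 0 < ω₂ → 0 < lam → 0 < β → ∀ T : ℝ, 0 < T →
      ∀ μ : MeasureTheory.Measure ChainConfig, (pinnedChain ω₂ lam β γ).IsChainGibbsMeasure T μ →
      IsShiftInvariant μ → μ.map (fun σ : ChainConfig => fun x : ℤ => ((σ x).1, -(σ x).2)) = μ →
      ∀ D : InfiniteChainDynamics (pinnedChain ω₂ lam β γ), D.PreservesMeasure μ →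
      ∃ B ν₀ : ℝ, 0 < ν₀ ∧ ∀ ν : ℝ, 0 < ν → ν < ν₀ →
        ∫ t in Set.Ioi (0:ℝ), Real.exp (-(ν * t)) * D.currentCorrelation μ t ≤ B := by
  intro ω₂ lam β γ hω hl hβ T hT μ hG hSI hR D hP
  -- (1) the window pair at bath constant 1 and its atom-free spectral window
  obtain ⟨μW, DW, hGW, hShW, hPW, hACW, σ, hσfin, hcosW, δ, g, hδ, hgc, hg0, hσres⟩ :=
    hW ω₂ lam β 1 hω hl hβ one_pos T hT
  have hatom : σ {0} = 0 := hN ω₂ lam β 1 hω hl hβ one_pos T hT μW DW hGW hShW hPW hACW σ hσfin hcosW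
  have hσres' : σ.restrict (Ioo (-δ) δ) =
      (volume.restrict (Ioo (-δ) δ)).withDensity (fun ω => ENNReal.ofReal (g ω)) := by
    rw [hσres, hatom, zero_smul, zero_add]
  have hlim : Tendsto (fun ν : ℝ => ∫ t in Set.Ioi (0:ℝ), Real.exp (-(ν * t)) * DW.currentCorrelation μW t)
      (𝓝[>] 0) (𝓝 (Real.pi * g 0)) :=
    Summit.AtomisticToContinuum.FouriersLaw.Theorems.AbelOfSpectralDensity.abelOfSpectralDensity_proof
      σ (DW.currentCorrelation μW) δ g hσfin hδ hcosW hgc hg0 hσres'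
  -- eventual bound on a right-neighbourhood of 0
  have hev : ∀ᶠ ν in 𝓝[>] (0:ℝ),
      ∫ t in Set.Ioi (0:ℝ), Real.exp (-(ν * t)) * DW.currentCorrelation μW t < Real.pi * g 0 + 1 :=
    hlim.eventually (gt_mem_nhds (lt_add_one _))
  obtain ⟨ν₀, hν₀, hsub⟩ := mem_nhdsGT_iff_exists_Ioo_subset.1 hev
  -- (2) transfer: the guarded pair's `C_T` is the window pair's
  have hSIW : IsShiftInvariant μW := (hShW 1).map_eq
  have hG₁ : (pinnedChain ω₂ lam β 1).IsChainGibbsMeasure T μ := hG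
  have hμ : μW = μ :=
    OscillatorChain.eq_of_isChainGibbsMeasure_of_isShiftInvariant_pinnedChain 1 hω hl.le hβ.le hT hGW hSIW hG₁ hSI
  subst hμ
  -- canonical twin of `D` (chain `γ`), transported to bath constant 1
  obtain ⟨D', hcar, -, -, hP', -, -, hCC⟩ :=
    Summit.AtomisticToContinuum.FouriersLaw.Theorems.AbelSpreadCeiling.RegularityCollapse.stub_canonicalTwin
      ω₂ lam β γ hω hl hβ T hT μW hG hSI hR D hP
  let D₁ : InfiniteChainDynamics (pinnedChain ω₂ lam β 1) :=
    ⟨D'.carrier, D'.flow, D'.mapsTo, D'.flow_zero, D'.isSolution, D'.unique⟩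
  have hP₁ : D₁.PreservesMeasure μW := hP'
  have hcc₁ : ∀ t : ℝ, D₁.currentCorrelation μW t = D.currentCorrelation μW t := fun t => by
    rw [← hCC t]; rfl
  -- canonical twin of the window dynamics (chain 1)
  obtain ⟨DW', hcarW, -, -, -, -, -, hCCW⟩ :=
    Summit.AtomisticToContinuum.FouriersLaw.Theorems.AbelSpreadCeiling.RegularityCollapse.stub_canonicalTwin
      ω₂ lam β 1 hω hl hβ T hT μW hGW hSIW hR DW hPW
  have hsub' : D₁.carrier ⊆ DW'.carrier := by
    rw [hcarW]
    exact subset_of_eq hcar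
  have hae : ∀ t : ℝ, D₁.flow t =ᵐ[μW] DW'.flow t := flow_ae_eq_of_carrier_subset D₁ DW' hsub' hP₁.1
  have hC : ∀ t : ℝ, D.currentCorrelation μW t = DW.currentCorrelation μW t := fun t => by
    rw [← hcc₁ t, ← hCCW t]
    exact
      Summit.AtomisticToContinuum.FouriersLaw.Theorems.AbelSpreadCeiling.RegularityCollapse.currentCorrelation_congr_ae
        D₁ DW' μW hae t
  -- (3) the ceiling
  refine ⟨Real.pi * g 0 + 1, ν₀, hν₀, fun ν hν hνlt => ?_⟩
  have hmem : ν ∈ {ν : ℝ | ∫ t in Set.Ioi (0:ℝ), Real.exp (-(ν * t)) * DW.currentCorrelation μW t <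
      Real.pi * g 0 + 1} := hsub ⟨hν, hνlt⟩
  simp only [mem_setOf_eq] at hmem
  simp only [hC]
  exact hmem.le

/-- **`WindowDecomposition → NoDrudeWeight → LinearCeiling`** — close-on-close certificate: the crux
`CoercivePulse.LinearCeiling` (item stmt-AtomisticToContinuum-15383) follows from the two cruxes stmt-14011 ∧ stmt-14012
of route `LatticeLandauDamping` (window decomposition of the current spectral measure with a continuous density and no
Drude atom), through the infinite-volume Abel ceiling and the landed stubs of line `SpikeLemma` (cosine Bochner,
Fejér/Abel kernel comparison, Helfand's identity; anchor `t₃ = 0`). [cite: Helfand1960, §II] -/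
theorem linearCeiling_of_windowDecomposition_of_noDrudeWeight (hW : WindowDecomposition) (hN : NoDrudeWeight) :
    LinearCeiling := by
  intro ω₂ lam β γ hω hl hβ T hT μ hG hSI hRv D hP hSh h hh S hS hSum
  obtain ⟨B, ν₀, hν₀, hA⟩ :=
    abelCeiling_of_windowDecomposition_of_noDrudeWeight hW hN ω₂ lam β γ hω hl hβ T hT μ hG hSI hRv D hP
  obtain ⟨σ, hσ, hC⟩ := stub_spectralRepresentation ω₂ lam β γ hω hl hβ T hT μ hG hSI hRv D hP
  obtain ⟨b, hb⟩ := stub_envelopeOfSpectralAbelBound σ hσ _ hC B ν₀ hν₀ hA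
  refine ⟨b, 0, fun t ht => ?_⟩
  rcases eq_or_lt_of_le ht with h0 | h0
  · subst h0
    simp
  · have hH := stub_helfandMoment ω₂ lam β γ hω hl hβ T hT μ hG hSI hRv D hP hSh h hh S hS hSum t h0
    have hbt := hb t ht
    rw [sub_zero]
    linarith

end Summit.AtomisticToContinuum.FouriersLaw.Theorems.LinearCeiling.SpikeLemma

end
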